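import Literature.NumberTheory.EllipticCurves.IwasawaTwistModPShapiroCores
import Literature.NumberTheory.GaloisRepresentations.ContinuousCorestrictionConj
import HarnessLib

/-!
# Shapiro for the Iwasawa twists, III: the dictionary **`γ ↔ (1+S)^{-κ̄(γ)}`** — the Galois action
# `conj_g` on `H¹(K_n, M)` becomes multiplication by `(1+T)^{-κ̄_n(g)}` on `H¹(K, 𝒯_{p^n})`

Topic `NumberTheory/EllipticCurves` (sequel of `IwasawaTwistModPShapiroCores`); namespace
`Literature.NumberTheory.EllipticCurves.ZpExtension`.  Cell `bsd-smallim` (rung K6 of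
`BirchSwinnertonDyer`, crux `MuTransferX9` = item 19276, open stub `stub_coreX9`), seat `bsd-smallim-k6-ty`
(typer), CORE-PLAN S2.1 dictionary entry "`conj_γ − 1 ↔ T`": under the inverse Shapiro map
`coresShapiro n = Sh_n⁻¹ : H¹(Γ_n, M) → H¹(Γ_K, 𝒯_{p^n})` (corestriction after `m ↦ m·T⁰`), the action
`conjMap ρ Γ_n g 1` of `g ∈ Γ_K` on `H¹(Γ_n, M)` (through which `T ∈ Λ` acts as `conj_γ − 1` on the
pinned `𝐇¹`, `Kato2004.IwasawaH1Data.proj_T_smul`, `red_X_smul`) corresponds to the module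
automorphism `(1+S)^{a}` of `𝒯_{p^n}` for any `a ≡ −κ̄_n(g) (mod p^n)` — for a topological generator
`γ` (`κ̄_n(γ) = 1`): `(1+S)^{p^n − 1} = (1+T)^{−1}`, so `conj_γ − 1 ↔ (1+T)^{−1} − 1 = −T(1+T)^{−1}`, a
unit multiple of `T`.  DEFINITIONS with bodies and PROOFS; no fact, no instance, no notation.

* `subgroupRepHom`, `cohomologyMap_cores` (generic, namespace `…GaloisRepresentations`): `H¹` of a
  `G`-equivariant coefficient map commutes with the explicit corestriction `cores : H¹(N, ·) → H¹(G, ·)`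
  (proved on cocycles).
* `twistModPUnipotent κ ρ hM J a : 𝒯_J →ⁱL 𝒯_J` — `(1+S)^a` as a continuous `Γ_K`-equivariant map
  (`𝒯_J` is a `𝔽_p[T]/(T^J)[Γ_K]`-module).
* **`coresShapiro_conjMap`**: for `g ∈ Γ_K`, `c ∈ H¹(Γ_n, M)` and any `a : ℕ` with
  `(a : ℤ/p^n) = −κ̄_n(g)`:
  `coresShapiro n (conjMap ρ Γ_n g 1 c) = H¹((1+S)^a) (coresShapiro n c)`.
  Proof: on cocycles `(g·φ)·T⁰ = (1+S)^a · (g · (φ·T⁰))` (`g` acts on `m·T⁰` by `(1+S)^{κ̄(g)} ρ(g)`),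
  then `cor` commutes with `H¹((1+S)^a)` (`cohomologyMap_cores`) and is invariant under `g·`
  (`cores_conjMap`, `ContinuousCorestrictionConj.lean`).
* `coresShapiro_conjMap_of_layerIndex_eq_one` / `coresShapiro_conjMap_of_isTopGenerator`: the case
  `g = γ` a topological generator, `a = p^n − 1` (`(1+S)^{p^n−1} = (1+T)^{−1}`).

## References

* J.-P. Serre, *Galois Cohomology* (1997), I §2.5 (Prop. 10, (b), and Exercise 1: the `G/H`-action on
  `M_G^H(A)` induces the natural action on `H^q(H, A)`). [SerreGaloisCohomology1997]
* J. Neukirch, A. Schmidt, K. Wingberg, *Cohomology of Number Fields* (2008), (1.6.4)–(1.6.5),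
  Prop. 1.5.4. [NeukirchSchmidtWingberg2008]
* L. Washington, *Introduction to Cyclotomic Fields* (1997), §13.1–§13.2 (`T = γ − 1`). [Washington1997]
-/

noncomputable section

open scoped Topology ContRepresentation
open Field Filter CategoryTheory

universe u w

namespace Literature.NumberTheory.GaloisRepresentations

/-! ## Naturality of the corestriction `H¹(N, ·) → H¹(G, ·)` in `G`-equivariant coefficients -/

section CoresNaturality

variable {k : Type w} [CommRing k] [TopologicalSpace k]
variable {G : Type u} [Group G] [TopologicalSpace G] [IsTopologicalGroup G]
variable {X Y : TopRep.{u} k G}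

/-- A morphism `f : X ⟶ Y` of topological representations restricted to a subgroup `H`.
[cite: SerreGaloisCohomology1997, I §2.4] -/
def subgroupRepHom (f : X ⟶ Y) (H : Subgroup G) : subgroupRep X H ⟶ subgroupRep Y H :=
  TopRep.ofHom ⟨f.hom.toContinuousLinearMap, fun h ↦ f.hom.isIntertwining' (h : G)⟩

omit [TopologicalSpace G] [IsTopologicalGroup G] in
/-- `subgroupRepHom f H` is `f` on elements. [cite: SerreGaloisCohomology1997, I §2.4] -/
@[simp] theorem subgroupRepHom_hom_apply (f : X ⟶ Y) (H : Subgroup G) (x : X) :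
    (subgroupRepHom f H).hom x = f.hom x := rfl

/-- **`H¹(f)` commutes with the corestriction `cor : H¹(N, ·) → H¹(G, ·)`** for a morphism `f : X ⟶ Y`
of topological representations of `G` and an open subgroup `N` of finite index ("Cor is a morphism of
cohomological functors"; on cocycles both sides are the transfer
`g ↦ Σ_x s(g·x) • f(φ(s(g·x)⁻¹ g s(x)))`). [cite: SerreGaloisCohomology1997, I §2.4]
[cite: NeukirchSchmidtWingberg2008, I §5] -/
theorem cohomologyMap_cores (f : X ⟶ Y) (N : Subgroup G) (hN : IsOpen (N : Set G))
    [Fintype (G ⧸ N)] (c : continuousCohomology 1 (subgroupRep X N)) :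
    cohomologyMap f 1 (cores X N hN c) = cores Y N hN (cohomologyMap (subgroupRepHom f N) 1 c) := by
  obtain ⟨φ, rfl⟩ := oneCocycleClass_surjective _ c
  rw [cores_oneCocycleClass X N hN QuotientGroup.out_eq' φ, cohomologyMap_oneCocycleClass,
    cohomologyMap_oneCocycleClass, cores_oneCocycleClass Y N hN QuotientGroup.out_eq']
  refine congrArg _ (Subtype.ext (ContinuousMap.ext fun g ↦ ?_))
  rw [pullback_id_resIdHom_apply, transferCocycle_apply, transferCocycle_apply, transferFun_apply,
    transferFun_apply, map_sum]
  refine Finset.sum_congr rfl fun x _ ↦ ?_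
  rw [TopRep.hom_comm_apply, pullback_id_resIdHom_apply, subgroupRepHom_hom_apply]

end CoresNaturality

end Literature.NumberTheory.GaloisRepresentations

namespace Literature.NumberTheory.EllipticCurves

open Literature.NumberTheory.GaloisRepresentations

namespace ZpExtension

variable {K : Type u} [Field K] {p : ℕ} [Fact p.Prime] (κ : ZpExtension K p)
variable {M : Type u} [AddCommGroup M] [TopologicalSpace M] [DiscreteTopology M]
variable (ρ : DiscreteGaloisModule K M) (hM : ∀ x : M, p • x = 0)

/-! ## `(1+S)^a` as an equivariant automorphism of `𝒯_J`, and on `H¹(K, 𝒯_J)` -/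

section Unipotent

variable (J : ℕ)

/-- **`(1+S)^a : 𝒯_J → 𝒯_J`** (multiplication by `(1+T)^a` on `M ⊗ 𝔽_p[T]/(T^J)(χ_κ)`) as a continuous
`Γ_K`-equivariant map: it commutes with the twisted action `(1+S)^{κ̄(g)} ρ(g)`
(`unipotentPow_add`, `unipotentPow_mul_compLeft`). [cite: Washington1997, §13.1–§13.2] -/
def twistModPUnipotent (a : ℕ) :
    (κ.twistModP ρ hM J).toContRepresentation →ⁱL (κ.twistModP ρ hM J).toContRepresentation where
  toContinuousLinearMap :=
    { toFun := unipotentPow M J a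
      map_add' := map_add _
      map_smul' := fun c x ↦ by rw [map_zsmul, RingHom.id_apply]
      cont := continuous_of_discreteTopology }
  isIntertwining' g := by
    refine ContinuousLinearMap.ext fun x ↦ ?_
    change (unipotentPow M J a * (unipotentPow M J (κ.twistExponent J g) * (ρ g).compLeft (Fin J))) x =
      (unipotentPow M J (κ.twistExponent J g) * (ρ g).compLeft (Fin J) * unipotentPow M J a) x
    rw [← mul_assoc, ← unipotentPow_add, add_comm, unipotentPow_add, mul_assoc,
      unipotentPow_mul_compLeft, ← mul_assoc]

/-- Unfolding `twistModPUnipotent`: it is `unipotentPow M J a` on elements.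
[cite: Washington1997, §13.1–§13.2] -/
@[simp] theorem twistModPUnipotent_apply (a : ℕ) (x : Fin J → M) :
    κ.twistModPUnipotent ρ hM J a x = unipotentPow M J a x := rfl

/-- **`(1+T)^a` on `H¹(K, 𝒯_J)`**: the map induced by `(1+S)^a` (functoriality of `H¹(K, –)`).
[cite: SerreGaloisCohomology1997, I §2.2] -/
def unipotentH1 (a : ℕ) :
    galoisCohomology (κ.twistModP ρ hM J) 1 →+ galoisCohomology (κ.twistModP ρ hM J) 1 :=
  galoisCohomology.map (κ.twistModPUnipotent ρ hM J a) 1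

/-- `unipotentH1 a` is `galoisCohomology.map` of `twistModPUnipotent a` (unfolding).
[cite: SerreGaloisCohomology1997, I §2.2] -/
theorem unipotentH1_apply (a : ℕ) (c : galoisCohomology (κ.twistModP ρ hM J) 1) :
    κ.unipotentH1 ρ hM J a c = galoisCohomology.map (κ.twistModPUnipotent ρ hM J a) 1 c := rfl

end Unipotent

/-! ## `γ ↔ (1+S)^{-κ̄(γ)}` under the inverse Shapiro map -/

section ConjDictionary

variable (n : ℕ) [Fintype (absoluteGaloisGroup K ⧸ κ.layerSubgroup n)]

/-- `0 < p^n`. [folklore] -/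
private theorem pow_pos_aux' : 0 < p ^ n := pow_pos (Fact.out : p.Prime).pos n

/-- `n ≤ p^n`. [folklore] -/
private theorem le_pow_self_aux' : n ≤ p ^ n := (Nat.lt_pow_self (Fact.out : p.Prime).one_lt).le

omit [Fintype (absoluteGaloisGroup K ⧸ κ.layerSubgroup n)] in
/-- **`(1+S)^a (g · (m·T⁰)) = (ρ(g) m)·T⁰` when `a ≡ −κ̄_n(g) (mod p^n)`**: `g` acts on `m·T⁰` by
`(1+S)^{κ̄_n(g)}` after `ρ(g)`, and `(1+S)^{p^n} = 1` on `𝒯_{p^n}`. [cite: Washington1997, §13.1–§13.2] -/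
theorem unipotentPow_twistModP_unitCoeff (g : absoluteGaloisGroup K) {a : ℕ}
    (ha : (a : ZMod (p ^ n)) = -κ.layerIndex n g) (m : M) :
    unipotentPow M (p ^ n) a (κ.twistModP ρ hM (p ^ n) g (unitCoeff n m)) = unitCoeff n (ρ g m) := by
  rw [twistModP_apply, ← Module.End.mul_apply, ← unipotentPow_add]
  have hsingle : (fun i ↦ ρ g ((unitCoeff (p := p) n m : Fin (p ^ n) → M) i)) =
      (unitCoeff (p := p) n (ρ g m) : Fin (p ^ n) → M) := by
    funext i
    rw [unitCoeff_apply, unitCoeff_apply]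
    exact Pi.apply_single (fun _ (x : M) ↦ ρ g x) (fun _ ↦ map_zero _)
      (⟨0, pow_pos_aux' n⟩ : Fin (p ^ n)) m i
  rw [hsingle]
  have hdvd : p ^ n ∣ a + κ.twistExponent (p ^ n) g := by
    rw [← ZMod.natCast_eq_zero_iff, Nat.cast_add, ha,
      κ.natCast_twistExponent n (p ^ n) (le_pow_self_aux' n), neg_add_cancel]
  rw [unipotentPow_eq_one_of_dvd hM le_rfl hdvd, Module.End.one_apply]

/-- **The dictionary `γ ↔ (1+S)^{-κ̄(γ)}` on `H¹`.**  For `g ∈ Γ_K`, `c ∈ H¹(Γ_n, M)` and `a : ℕ` with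
`a ≡ −κ̄_n(g) (mod p^n)`:
`coresShapiro n (g · c) = H¹((1+S)^a) (coresShapiro n c)` in `H¹(K, 𝒯_{p^n})`, where `g · c` is the
conjugation action `conjMap ρ Γ_n g 1` on `H¹(Γ_n, M) = H¹(K_n, M)` and `coresShapiro n = Sh_n⁻¹`
(`coresShapiro_eq_symm`).  On cocycles: `(g·φ)·T⁰ = (1+S)^a·(g·(φ·T⁰))`; then `cor` commutes with the
`Γ_K`-equivariant `(1+S)^a` (`cohomologyMap_cores`) and `cor (g · y) = cor y` (`cores_conjMap`).  This is
Serre's "the `G/H`-action on `M_G^H(A)` induces the natural action on `H^q(H, A)`" for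
`M_G^{Γ_n}(M) ≅ 𝒯_{p^n}`, where `g` acts on the induced module by `(1+T)^{−κ̄(g)}`.
[cite: SerreGaloisCohomology1997, I §2.5 (b) and Exercise 1] [cite: NeukirchSchmidtWingberg2008, Prop. 1.5.4] -/
theorem coresShapiro_conjMap (g : absoluteGaloisGroup K) {a : ℕ}
    (ha : (a : ZMod (p ^ n)) = -κ.layerIndex n g)
    (c : continuousCohomology 1 (subgroupRep ρ.toTopRep (κ.layerSubgroup n))) :
    κ.coresShapiro ρ hM n (conjMap ρ.toTopRep (κ.layerSubgroup n) g 1 c) =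
      κ.unipotentH1 ρ hM (p ^ n) a (κ.coresShapiro ρ hM n c) := by
  classical
  obtain ⟨φ, rfl⟩ := oneCocycleClass_surjective _ c
  -- the `Γ_K`-equivariant coefficient map `(1+S)^a` as a morphism of `TopRep`
  set F : (κ.twistModP ρ hM (p ^ n)).toTopRep ⟶ (κ.twistModP ρ hM (p ^ n)).toTopRep :=
    TopRep.ofHom ⟨(κ.twistModPUnipotent ρ hM (p ^ n) a).toContinuousLinearMap,
      (κ.twistModPUnipotent ρ hM (p ^ n) a).isIntertwining'⟩ with hF
  -- cocycle identity: `(g·φ)·T⁰ = (1+S)^a · (g · (φ·T⁰))`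
  have hcocycle :
      contOneCocycles.pullback (ContinuousMonoidHom.id _) (resIdHom (κ.unitCoeffHom ρ hM n))
          (contOneCocycles.pullback (subgroupConj (κ.layerSubgroup n) g)
            (conjRepHom ρ.toTopRep (κ.layerSubgroup n) g) φ) =
        contOneCocycles.pullback (ContinuousMonoidHom.id _)
          (resIdHom (subgroupRepHom F (κ.layerSubgroup n)))
          (contOneCocycles.pullback (subgroupConj (κ.layerSubgroup n) g)
            (conjRepHom (κ.twistModP ρ hM (p ^ n)).toTopRep (κ.layerSubgroup n) g)
            (contOneCocycles.pullback (ContinuousMonoidHom.id _)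
              (resIdHom (κ.unitCoeffHom ρ hM n)) φ)) := by
    refine Subtype.ext (ContinuousMap.ext fun u ↦ ?_)
    rw [pullback_id_resIdHom_apply, conj_pullback_apply, pullback_id_resIdHom_apply,
      conj_pullback_apply, pullback_id_resIdHom_apply, unitCoeffHom_hom_apply, unitCoeffHom_hom_apply,
      subgroupRepHom_hom_apply, ContinuousRep.toTopRep_ρ_apply, ContinuousRep.toTopRep_ρ_apply]
    exact (κ.unipotentPow_twistModP_unitCoeff ρ hM n g ha _).symm
  -- assemble
  rw [conjMap_oneCocycleClass]
  change cores _ _ _ (cohomologyMap (κ.unitCoeffHom ρ hM n) 1 (oneCocycleClass _ _)) =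
    cohomologyMap F 1 (cores _ _ _ (cohomologyMap (κ.unitCoeffHom ρ hM n) 1 (oneCocycleClass _ φ)))
  conv_lhs => rw [cohomologyMap_oneCocycleClass, hcocycle, ← cohomologyMap_oneCocycleClass,
    ← conjMap_oneCocycleClass, ← cohomologyMap_oneCocycleClass]
  rw [← cohomologyMap_cores, cores_conjMap]

/-- **`T ↔ conj_γ − 1`, the case of a topological generator.**  If `κ̄_n(γ) = 1` (e.g. `κ γ = 1`,
`IsTopGenerator`), then `coresShapiro n (γ · c) = H¹((1+S)^{p^n − 1}) (coresShapiro n c)`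
(`(1+S)^{p^n−1} = (1+T)^{−1}` on `𝒯_{p^n}`); hence `coresShapiro n ((conj_γ − 1) c) =
(H¹((1+T)^{−1}) − 1)(coresShapiro n c)`, and `(1+T)^{−1} − 1 = −T·(1+T)^{−1}` is a unit multiple of
`T`. [cite: Washington1997, §13.1–§13.2] [cite: SerreGaloisCohomology1997, I §2.5 (b) and Exercise 1] -/
theorem coresShapiro_conjMap_of_layerIndex_eq_one {γ : absoluteGaloisGroup K}
    (hγ : κ.layerIndex n γ = 1)
    (c : continuousCohomology 1 (subgroupRep ρ.toTopRep (κ.layerSubgroup n))) :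
    κ.coresShapiro ρ hM n (conjMap ρ.toTopRep (κ.layerSubgroup n) γ 1 c) =
      κ.unipotentH1 ρ hM (p ^ n) (p ^ n - 1) (κ.coresShapiro ρ hM n c) := by
  refine κ.coresShapiro_conjMap ρ hM n γ ?_ c
  rw [hγ, Nat.cast_sub (Nat.one_le_pow _ _ (Fact.out : p.Prime).pos), ZMod.natCast_self, zero_sub,
    Nat.cast_one]

omit [Fintype (absoluteGaloisGroup K ⧸ κ.layerSubgroup n)] in
/-- A topological generator `γ` of `κ` (`κ γ = 1`) has `κ̄_n(γ) = 1` at every level.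
[cite: Washington1997, §13.1–§13.2] -/
theorem layerIndex_eq_one_of_isTopGenerator {γ : absoluteGaloisGroup K} (hγ : κ.IsTopGenerator γ) :
    κ.layerIndex n γ = 1 := by
  rw [layerIndex, hγ]
  simp

/-- **`T ↔ conj_γ − 1` for a topological generator `γ` of `κ`** (`κ γ = 1`):
`coresShapiro n (γ · c) = H¹((1+S)^{p^n − 1}) (coresShapiro n c)`, i.e. `Sh_n⁻¹ ∘ conj_γ =
(1+T)^{−1} ∘ Sh_n⁻¹` on `H¹(K_n, M) → H¹(K, 𝒯_{p^n})`.
[cite: Washington1997, §13.1–§13.2] [cite: SerreGaloisCohomology1997, I §2.5 (b) and Exercise 1] -/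
theorem coresShapiro_conjMap_of_isTopGenerator {γ : absoluteGaloisGroup K} (hγ : κ.IsTopGenerator γ)
    (c : continuousCohomology 1 (subgroupRep ρ.toTopRep (κ.layerSubgroup n))) :
    κ.coresShapiro ρ hM n (conjMap ρ.toTopRep (κ.layerSubgroup n) γ 1 c) =
      κ.unipotentH1 ρ hM (p ^ n) (p ^ n - 1) (κ.coresShapiro ρ hM n c) :=
  κ.coresShapiro_conjMap_of_layerIndex_eq_one ρ hM n (κ.layerIndex_eq_one_of_isTopGenerator n hγ) c

end ConjDictionary

end ZpExtension

end Literature.NumberTheory.EllipticCurves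

end
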